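import Mathlib

/-!
# SoloBlind — the reduced-trace obstruction of PROPOSITION Φ (b)

In the Hurwitz order, a `w_N`-fixed (resp. `Frob₂ w_N`-fixed) supersingular point gives an element `ψ` of
reduced norm `N` (resp. `2N`) with `ψ² = N u′` (resp. `2N u′`) for a unit `u′`; if `u′ ≠ -1`, taking
reduced norms in `tψ = N(1 + u′)` forces `t² = N · nrd(1 + u′)` with `nrd(1 + u′) ∈ {1, 2, 3, 4}`
(resp. `t² = 2N · nrd(1 + u′)`). The arithmetic fact certified here is that none of these eight equations
has a solution for a prime `N ≥ 5`: a prime dividing a square divides the root, so `N ∣ c` for the cofactor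
`c ∈ {1, 2, 3, 4, 6, 8}`, impossible. Hence `u′ = -1`, `ψ² = -N` (resp. `-2N`), and the fixed points are
exactly the CM points of `ℤ[√-N]` (resp. `ℤ[√-2N]`) — HOME/paper/theoremT.md, Proposition Φ (b).
-/

namespace Summit.Langlands.Langlands.Theorems

/-- If `t² = N c` with `N` prime then `N ∣ c`. -/
theorem soloBlind_prime_dvd_cofactor_of_sq {N c t : ℕ} (hN : N.Prime) (h : t ^ 2 = N * c) : N ∣ c := by
  have h1 : N ∣ t ^ 2 := ⟨c, h⟩
  have h2 : N ∣ t := hN.dvd_of_dvd_pow h1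
  obtain ⟨s, rfl⟩ := h2
  have h3 : N * (N * s ^ 2) = N * c := by rw [← h]; ring
  have h4 : N * s ^ 2 = c := Nat.eq_of_mul_eq_mul_left hN.pos h3
  exact ⟨s ^ 2, h4.symm⟩

/-- A prime `N ≥ 5` divides none of `1, 2, 3, 4, 6, 8`. -/
theorem soloBlind_prime_ge_five_not_dvd {N : ℕ} (hN : N.Prime) (h5 : 5 ≤ N) {c : ℕ}
    (hc : c = 1 ∨ c = 2 ∨ c = 3 ∨ c = 4 ∨ c = 6 ∨ c = 8) : ¬ N ∣ c := by
  intro hd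
  have hcpos : 0 < c := by rcases hc with h | h | h | h | h | h <;> omega
  have hle : N ≤ c := Nat.le_of_dvd hcpos hd
  have hN8 : N ≤ 8 := by rcases hc with h | h | h | h | h | h <;> omega
  interval_cases N <;> rcases hc with h | h | h | h | h | h <;> simp_all (config := { decide := true })

/-- PROPOSITION Φ (b), arithmetic core: for a prime `N ≥ 5` and any natural `t` (the absolute value of a
reduced trace), `t²` is none of `N, 2N, 3N, 4N` (norm-`N` case) nor `2N, 4N, 6N, 8N` (norm-`2N` case). -/
theorem soloBlind_trace_obstruction {N : ℕ} (hN : N.Prime) (h5 : 5 ≤ N) (t : ℕ) :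
    t ^ 2 ≠ N * 1 ∧ t ^ 2 ≠ N * 2 ∧ t ^ 2 ≠ N * 3 ∧ t ^ 2 ≠ N * 4 ∧
      t ^ 2 ≠ N * 6 ∧ t ^ 2 ≠ N * 8 := by
  refine ⟨?_, ?_, ?_, ?_, ?_, ?_⟩ <;> intro h <;>
    exact soloBlind_prime_ge_five_not_dvd hN h5 (by omega)
      (soloBlind_prime_dvd_cofactor_of_sq hN h)

end Summit.Langlands.Langlands.Theorems
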